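import Literature.MathematicalPhysics.QuantumFieldTheory.Balaban1983to89.HiggsFluctMeasurePos
import Literature.MathematicalPhysics.QuantumFieldTheory.Balaban1983to89.B6Eq232GaussianMoment

/-!
# `Balaban1983to89.HiggsFluctMeasureCov` — T. Bałaban, *(Higgs)₂,₃ quantum fields in a finite volume. I. A lower bound*,
Commun. Math. Phys. **85** (1982) 603–626 [Balaban1982Higgs1] p. 617: *"The fields A′_j … are independent Gaussian random
variables with the covariances C^{(j),L^jε}"* and p. 611 (2.30): *"We define a covariance C^{(k),L^kε}(Ω, A) by means of the
quadratic form in φ in this integral"* — PROVED for the concrete measures `dμ_{C^{(j),L^jη}}(A′_j)` of III (1.4) p. 412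
(`…HiggsFluctMeasure.fluctMeasure`, the normalised Gaussian weight `exp(−½⟨A′,(C^{(j)})^{−1}A′⟩)dA′` of I (3.35)): the
measure is CENTRED, its COVARIANCE IS `C^{(j),L^jη}` (`…HiggsFluctMeasure.fluctCov`, the inverse (2.30)) for the scalar
product (I.1.5), and its moment generating function is `exp(½⟨f, C^{(j)}f⟩)` — in the paper's regime `m² > 0` (vector mass
`msq > 0`), `a > 0`, `L > 1`, levels `j ≤ K`; theorems only

statement-level skeleton of published theorems with citation tags; proofs where landed; nothing here is a claim about the Yang–Mills mass gap

PDF held: `paper:balaban1982-cmp85-higgs23-i` (journal page = PDF page + 602); pp. 611, 617 read (`lit read … --pages 9,15`)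
and on the ×2 renders `run/shared/lean/pub/pub-balaban/b2b-balaban-ref1/pages/1982-cmp85-higgs23-I/…-p009, -p015-x2.png`;
III p. 412 on `…/1983-cmp88-higgs23-III/…-p002-x2.png`.

CITATION HEADER (lean-in-tree rule).  lit-balaban typed skeleton (HOME `run/shared/lean/pub/lit-balaban/`), typer
line, second companion of the carrier `HiggsFluctMeasure` (row **B3.Eq1.4**, owner r15; rows B1.Eq2.30 / B1.Eq2.21 of
r14 are NOT re-led here).  THE SOURCE TEXT.  I p. 611 [PDF 9], verbatim: *"Another important class of covariances is the
one connected with the effective integration in (2.18). We define a covariance C^{(k),L^kε}(Ω, A) by means of the quadratic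
form in φ in this integral: C^{(k),L^kε}(Ω, A) = (a(L^{k+1}ε)^{−2}P(A) + Δ^{(k),L^kε}(Ω, A))^{−1}. (2.30)"*; I p. 617
[PDF 15]: *"The fields A′_j defining the components of (3.33) are independent Gaussian random variables with the
covariances C^{(j),L^jε}."*; III p. 412 (1.4): *"∫dμ_{C^{(j),L^jη}}(A′_j)"*.  What "Gaussian with covariance `C`" means is
made explicit and PROVED for the tree's concrete objects: with `μ = fluctMeasure P msq a j`, `C = fluctCov P msq a j`,
`⟨·,·⟩ = HiggsLattice.siteInner` on `T^{(j)}` (weight `(L^jη)^d`) and `A′ ↦ toSite A′` (I p. 608, `N = d`):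
`∫⟨A′,f⟩dμ = 0` (`integral_siteInner_fluctMeasure`, unconditional), `∫⟨A′,f⟩⟨A′,g⟩dμ = ⟨f, Cg⟩`
(`integral_siteInner_mul_siteInner_fluctMeasure`) and `∫e^{⟨A′,f⟩}dμ = e^{½⟨f,Cf⟩}` (`integral_exp_siteInner_fluctMeasure`).

THE ARGUMENT (ours: the paper takes these Gaussian identities for granted; II [Balaban1984PropagatorsII] (2.32) p. 227
prints the generic one, vendored as `B6Eq232GaussianMoment.integral_gauss_bilinear`).  (§1) The operator of (2.30) is
SYMMETRIC for (1.5): `P(0)` by the fibrewise formula `⟨f,P(0)g⟩ = (L^jη)^dL^{−d}Σ_y⟨Σ_{B(y)}f, Σ_{B(y)}g⟩`; `Δ^{(0)} = −Δ^η + m²`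
by `HiggsCovariancePos.siteInner_covLaplacianN_comm`; `Δ^{(j)}`, `j ≥ 1`, in the solved form (2.21)
`a_j(L^jη)^{−2} − a_j²(L^jη)^{−4}Q_jG^η_jQ_j^*` by the adjointness (2.20) of `Q_j`, `Q_j^*` and the symmetry of
`G^η_j = (−Δ^η + m² + a_j(L^jη)^{−2}Q_j^*Q_j)^{−1}` (the inverse — `Ring.inverse`, value `0` off units — of a symmetric operator
is symmetric); hence so is `C^{(j)} = (…)^{−1}`.  (§2) Coordinates: along `E := EuclideanSpace ℝ (bonds of T^{(j)}) ≃ {A′}`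
(`WithLp.ofLp`, Lebesgue-measure preserving, `EuclideanSpace.volume_preserving_symm_measurableEquiv_toLp`) one has
`⟨toSite A, toSite B⟩ = (L^jη)^d Σ_b A_bB_b = (L^jη)^d⟪A,B⟫_E`, so `M := (L^jη)^d·(C^{(j)})^{−1}` and `G := (L^jη)^{−d}·C^{(j)}`
read in `E` satisfy `⟪v,Mv⟫_E = ⟨A′,(C^{(j)})^{−1}A′⟩`, `M` symmetric, `MG = 1` (`HiggsFluctMeasurePos.precOp_mul_fluctCov`),
`e^{−½⟪v,Mv⟫}` integrable (`HiggsFluctMeasurePos.integrable_gaussWeight`) with integral `gaussNorm`, and the sources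
`J_f := (L^jη)^d·f` give `⟪v,J_f⟫_E = ⟨A′,f⟩`, `⟪GJ_g, J_f⟫_E = ⟨f, C^{(j)}g⟩`.  (§3) `integral_gauss_bilinear` on `E`
(translation and reflection invariance of Lebesgue measure) and the completed square `gauss_shift_eq` give the three
identities after dividing by `gaussNorm > 0`; the first moment vanishes by oddness alone.
Unit `lit-balaban-typer` gen 4 (literature-prover-lit-balaban-typer-g4-0); HOME/FILED.md records the proposal.
-/

open scoped BigOperators ENNReal InnerProductSpace
open _root_.MeasureTheory

namespace Literature.MathematicalPhysics.QuantumFieldTheory.Balaban1983to89.HiggsFluctMeasureCov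

open Literature.MathematicalPhysics.QuantumFieldTheory.Balaban1983to89.HiggsLattice
open Literature.MathematicalPhysics.QuantumFieldTheory.Balaban1983to89.HiggsAveraging
open Literature.MathematicalPhysics.QuantumFieldTheory.Balaban1983to89.HiggsCovariance
open Literature.MathematicalPhysics.QuantumFieldTheory.Balaban1983to89.B3MultiscaleFields
open Literature.MathematicalPhysics.QuantumFieldTheory.Balaban1983to89.HiggsFluctMeasure
open Literature.MathematicalPhysics.QuantumFieldTheory.Balaban1983to89.HiggsCovariancePos
open Literature.MathematicalPhysics.QuantumFieldTheory.Balaban1983to89.HiggsCovarianceCont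
open Literature.MathematicalPhysics.QuantumFieldTheory.Balaban1983to89.HiggsFluctMeasurePos
open Literature.MathematicalPhysics.QuantumFieldTheory.Balaban1983to89.B6Eq232GaussianMoment

variable {P : Params}

/-! ## 1. The operator of (2.30) and the covariance `C^{(j),L^jη}` are symmetric for the scalar product (1.5) -/

section Symmetry

variable {j M : ℕ}

/-- `⟨f, 0⟩ = 0`. [cite: Balaban1982Higgs1, (1.5) p.604] -/
theorem siteInner_zero_right (f : ScalarField P j M) : siteInner f (0 : ScalarField P j M) = 0 := by
  simp [siteInner]

/-- The inverse (in the endomorphism ring; `0` off units) of an operator symmetric for (1.5) is symmetric for (1.5).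
[cite: Balaban1982Higgs1, (2.30) p.611] -/
theorem siteInner_inverse_comm (T : Module.End ℝ (ScalarField P j M))
    (hT : ∀ f g : ScalarField P j M, siteInner f (T g) = siteInner g (T f)) (f g : ScalarField P j M) :
    siteInner f (Ring.inverse T g) = siteInner g (Ring.inverse T f) := by
  by_cases hU : IsUnit T
  · have hTG : ∀ ψ, T (Ring.inverse T ψ) = ψ := fun ψ => by
      have h := congrArg (fun S : Module.End ℝ (ScalarField P j M) => S ψ) (Ring.mul_inverse_cancel T hU)
      simpa using h
    calc siteInner f (Ring.inverse T g)
        = siteInner (T (Ring.inverse T f)) (Ring.inverse T g) := by rw [hTG]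
      _ = siteInner (Ring.inverse T g) (T (Ring.inverse T f)) := siteInner_comm _ _
      _ = siteInner (Ring.inverse T f) (T (Ring.inverse T g)) := hT _ _
      _ = siteInner (Ring.inverse T f) g := by rw [hTG]
      _ = siteInner g (Ring.inverse T f) := siteInner_comm _ _
  · rw [Ring.inverse_non_unit _ hU, LinearMap.zero_apply, LinearMap.zero_apply, siteInner_zero_right,
      siteInner_zero_right]

/-- **`P(0)` as a bilinear form, fibrewise over the blocks**: `⟨f, P(0)g⟩ = (L^jη)^d·L^{−d}·Σ_{y∈T^{(j+1)}} ⟨Σ_{x∈B(y)}f(x), Σ_{x∈B(y)}g(x)⟩`.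
[cite: Balaban1982Higgs1, (2.30) p.611] -/
theorem siteInner_blockMean_eq (j : ℕ) (f g : ScalarField P j P.d) :
    siteInner f (blockMean P j g)
      = P.mesh j ^ P.d * (((P.L : ℝ) ^ P.d)⁻¹) *
          ∑ y : Site P (j + 1), ⟪∑ x ∈ block y, f x, ∑ x ∈ block y, g x⟫_ℝ := by
  unfold siteInner
  have hfib := Finset.sum_fiberwise_of_maps_to (s := (Finset.univ : Finset (Site P j)))
    (t := (Finset.univ : Finset (Site P (j + 1)))) (g := blockOf) (fun x _ => Finset.mem_univ _)
    (fun x => P.mesh j ^ P.d * ⟪f x, blockMean P j g x⟫_ℝ)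
  rw [← hfib, Finset.mul_sum]
  refine Finset.sum_congr rfl fun y _ => ?_
  have hblock : Finset.filter (fun x : Site P j => blockOf x = y) Finset.univ = block y := rfl
  rw [hblock]
  have hterm : ∀ x ∈ block y,
      P.mesh j ^ P.d * ⟪f x, blockMean P j g x⟫_ℝ
        = P.mesh j ^ P.d * (((P.L : ℝ) ^ P.d)⁻¹) * ⟪f x, ∑ x' ∈ block y, g x'⟫_ℝ := by
    intro x hx
    have hxy : blockOf x = y := by simpa [block] using hx
    rw [blockMean_apply, hxy, inner_smul_right]
    ring
  rw [Finset.sum_congr rfl hterm, ← Finset.mul_sum, ← sum_inner]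

/-- **`P(0)` is symmetric** for (1.5): `⟨f, P(0)g⟩ = ⟨g, P(0)f⟩`. [cite: Balaban1982Higgs1, (2.30) p.611] -/
theorem siteInner_blockMean_comm (j : ℕ) (f g : ScalarField P j P.d) :
    siteInner f (blockMean P j g) = siteInner g (blockMean P j f) := by
  rw [siteInner_blockMean_eq, siteInner_blockMean_eq]
  congr 1
  exact Finset.sum_congr rfl fun y _ => real_inner_comm _ _

/-- The operator `−Δ^η + m² + a_j(L^jη)^{−2}Q_j^*Q_j` of (2.20) (vector field, zero external field, `Ω = T`) is
symmetric for (1.5) (`−Δ^η` self-adjoint, p. 609; `Q_j^*` the adjoint of `Q_j`, (2.20)). [cite: Balaban1982Higgs1, (2.20) p.610] -/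
theorem siteInner_covOpK_comm (msq a : ℝ) (j : ℕ) (f g : ScalarField P 0 P.d) :
    siteInner f (covOpK (zeroCharge P.d) Finset.univ (0 : VecField P 0) msq a j g)
      = siteInner g (covOpK (zeroCharge P.d) Finset.univ (0 : VecField P 0) msq a j f) := by
  simp only [HiggsFluctMeasurePos.covOpK_eq, LinearMap.add_apply, LinearMap.smul_apply, LinearMap.id_apply,
    LinearMap.comp_apply, siteInner_add_right, siteInner_smul_right]
  rw [siteInner_covLaplacianN_comm, ← siteInner_vecQ_adj, ← siteInner_vecQ_adj, siteInner_comm f g,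
    siteInner_comm (vecQ P j f) (vecQ P j g)]

/-- **`G^η_j` is symmetric** for (1.5) (the inverse of the symmetric operator of (2.20)). [cite: Balaban1982Higgs1, (2.20) p.610] -/
theorem siteInner_vecG_comm (msq a : ℝ) (j : ℕ) (f g : ScalarField P 0 P.d) :
    siteInner f (vecG P msq a j g) = siteInner g (vecG P msq a j f) :=
  siteInner_inverse_comm _ (siteInner_covOpK_comm msq a j) f g

/-- `⟨f, Q_jG^η_jQ_j^*g⟩ = ⟨g, Q_jG^η_jQ_j^*f⟩` — the operator of (2.21) is symmetric (adjointness (2.20) twice and the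
symmetry of `G^η_j`). [cite: Balaban1982Higgs1, (2.21) p.610] -/
theorem siteInner_QGQAdj_comm (msq a : ℝ) (j : ℕ) (f g : ScalarField P j P.d) :
    siteInner f (vecQ P j (vecG P msq a j (vecQAdj P j g))) = siteInner g (vecQ P j (vecG P msq a j (vecQAdj P j f))) := by
  rw [siteInner_comm f, siteInner_vecQ_adj, siteInner_comm _ (vecQAdj P j f), siteInner_vecG_comm,
    siteInner_comm (vecQAdj P j g), ← siteInner_vecQ_adj, siteInner_comm _ g]

/-- **`Δ^{(j),L^jη}` is symmetric** for (1.5) — `j = 0`: (2.17); `j ≥ 1`: the solved form (2.21). [cite: Balaban1982Higgs1, (2.21) p.610] -/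
theorem siteInner_deltaK_comm (msq a : ℝ) : ∀ (j : ℕ) (f g : ScalarField P j P.d),
    siteInner f (deltaK P msq a j g) = siteInner g (deltaK P msq a j f)
  | 0, f, g => by
      simp only [deltaK_zero, LinearMap.add_apply, LinearMap.smul_apply, LinearMap.id_apply, siteInner_add_right,
        siteInner_smul_right]
      rw [siteInner_covLaplacianN_comm, siteInner_comm f g]
  | j + 1, f, g => by
      simp only [deltaK_succ, LinearMap.sub_apply, LinearMap.smul_apply, LinearMap.id_apply, LinearMap.comp_apply,
        siteInner_sub_right, siteInner_smul_right]
      rw [siteInner_comm f g, siteInner_QGQAdj_comm]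

/-- **The operator `a(L^{j+1}η)^{−2}P(0) + Δ^{(j),L^jη}` of (2.30) is symmetric** for (1.5). [cite: Balaban1982Higgs1, (2.30) p.611] -/
theorem siteInner_precOp_comm (msq a : ℝ) (j : ℕ) (f g : ScalarField P j P.d) :
    siteInner f (precOp P msq a j g) = siteInner g (precOp P msq a j f) := by
  rw [precOp_eq, LinearMap.add_apply, LinearMap.add_apply, LinearMap.smul_apply, LinearMap.smul_apply,
    siteInner_add_right, siteInner_add_right, siteInner_smul_right, siteInner_smul_right,
    siteInner_blockMean_comm, siteInner_deltaK_comm]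

/-- **The covariance `C^{(j),L^jη}` (2.30) is symmetric** for (1.5). [cite: Balaban1982Higgs1, (2.30) p.611] -/
theorem siteInner_fluctCov_comm (msq a : ℝ) (j : ℕ) (f g : ScalarField P j P.d) :
    siteInner f (fluctCov P msq a j g) = siteInner g (fluctCov P msq a j f) :=
  siteInner_inverse_comm _ (siteInner_precOp_comm msq a j) f g

end Symmetry

/-! ## 2. Coordinates: the scalar product (1.5) of bond functions and `EuclideanSpace ℝ (bonds)` -/

section Coordinates

variable {j : ℕ}

/-- `⟨(toSite A)(x), (toSite B)(x)⟩_{ℝ^d} = Σ_μ A_μ(x)B_μ(x)`. [cite: Balaban1982Higgs1, p.608] -/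
theorem inner_toSite_apply (A B : VecField P j) (x : Site P j) :
    ⟪toSite A x, toSite B x⟫_ℝ = ∑ μ : Fin P.d, A ⟨x, μ⟩ * B ⟨x, μ⟩ := by
  show ⟪WithLp.toLp 2 (fun μ : Fin P.d => A ⟨x, μ⟩), WithLp.toLp 2 (fun μ : Fin P.d => B ⟨x, μ⟩)⟫_ℝ = _
  rw [EuclideanSpace.inner_toLp_toLp]
  simp only [dotProduct, Pi.star_apply, star_trivial]
  exact Finset.sum_congr rfl fun μ _ => mul_comm _ _

/-- **(1.5) for bond functions read as `ℝ^d`-valued site functions**: `⟨toSite A, toSite B⟩ = (L^jη)^d Σ_b A_bB_b`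
(p. 607: the scalar product *"for the functions defined … on the bonds"*). [cite: Balaban1982Higgs1, (1.5) p.604] -/
theorem siteInner_toSite_toSite (A B : VecField P j) :
    siteInner (toSite A) (toSite B) = P.mesh j ^ P.d * ∑ b : PBond P j, A b * B b := by
  unfold siteInner
  rw [← Finset.mul_sum]
  congr 1
  simp_rw [inner_toSite_apply]
  rw [sum_site_dir (fun x μ => A ⟨x, μ⟩ * B ⟨x, μ⟩)]

/-- The same in the coordinates `EuclideanSpace ℝ (bonds)`: `⟨toSite v, toSite w⟩ = (L^jη)^d⟪v, w⟫`. [cite: Balaban1982Higgs1, (1.5) p.604] -/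
theorem siteInner_toSite_ofLp (v w : EuclideanSpace ℝ (PBond P j)) :
    siteInner (toSite (WithLp.ofLp v : VecField P j)) (toSite (WithLp.ofLp w : VecField P j))
      = P.mesh j ^ P.d * ⟪v, w⟫_ℝ := by
  rw [siteInner_toSite_toSite, EuclideanSpace.inner_eq_star_dotProduct]
  congr 1
  simp only [dotProduct, Pi.star_apply, star_trivial]
  exact Finset.sum_congr rfl fun b _ => mul_comm _ _

/-- The source dictionary: `⟪v, (L^jη)^d·h⟫ = ⟨toSite v, toSite h⟩`. [cite: Balaban1982Higgs1, (1.5) p.604] -/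
theorem inner_smul_toLp (v : EuclideanSpace ℝ (PBond P j)) (h : VecField P j) :
    ⟪v, (P.mesh j ^ P.d) • (WithLp.toLp 2 h : EuclideanSpace ℝ (PBond P j))⟫_ℝ
      = siteInner (toSite (WithLp.ofLp v : VecField P j)) (toSite h) := by
  rw [real_inner_smul_right, ← siteInner_toSite_ofLp, WithLp.ofLp_toLp]

/-- `toSite (−A) = −toSite A`. [cite: Balaban1982Higgs1, p.608] -/
theorem toSite_neg (A : VecField P j) : toSite (-A) = -toSite A := by
  rw [← neg_one_smul ℝ A, toSite_smul, neg_one_smul]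

/-- `⟨toSite (−A), toSite f⟩ = −⟨toSite A, toSite f⟩`. [cite: Balaban1982Higgs1, (1.5) p.604] -/
theorem siteInner_toSite_neg (A f : VecField P j) :
    siteInner (toSite (-A)) (toSite f) = -siteInner (toSite A) (toSite f) := by
  rw [toSite_neg, ← neg_one_smul ℝ (toSite A), siteInner_smul_left, neg_one_mul]

/-- The Gaussian weight is even: `exp(−½⟨−A′,(C^{(j)})^{−1}(−A′)⟩) = exp(−½⟨A′,(C^{(j)})^{−1}A′⟩)`. [cite: Balaban1982Higgs1, (3.35) p.618] -/
theorem gaussWeight_neg (msq a : ℝ) (j : ℕ) (A : VecField P j) :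
    gaussWeight P msq a j (-A) = gaussWeight P msq a j A := by
  rw [gaussWeight_eq, gaussWeight_eq, ← neg_one_smul ℝ A, quadForm_smul]
  norm_num

/-- **Transfer of the Lebesgue integral `∫dA′_j`** (p. 605) to `EuclideanSpace ℝ (bonds of T^{(j)})` along `WithLp.ofLp`
(volume preserving). [cite: Balaban1982Higgs1, (1.5) p.604] -/
theorem integral_vecField_eq_integral_euclidean {F' : Type*} [NormedAddCommGroup F'] [NormedSpace ℝ F']
    (F : VecField P j → F') :
    ∫ A, F A = ∫ v : EuclideanSpace ℝ (PBond P j), F (WithLp.ofLp v) :=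
  ((EuclideanSpace.volume_preserving_symm_measurableEquiv_toLp (PBond P j)).integral_comp' F).symm

end Coordinates

/-! ## 3. `(C^{(j)})^{−1}` and `C^{(j)}` in coordinates; the Gaussian identities -/

section Moments

variable {j : ℕ}

/-- **The Gaussian dictionary.**  For `msq > 0`, `a > 0`, `L > 1`, `j ≤ K` there are operators `M`, `G` on
`E = EuclideanSpace ℝ (bonds)` — `M = (L^jη)^d(C^{(j)})^{−1}`, `G = (L^jη)^{−d}C^{(j)}` in coordinates — with `M` symmetric,
`MG = 1`, `e^{−½⟪v,Mv⟫} = exp(−½⟨A′,(C^{(j)})^{−1}A′⟩)` integrable with integral `gaussNorm`, and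
`⟪G((L^jη)^d g), (L^jη)^d f⟫ = ⟨toSite f, C^{(j)} toSite g⟩`. [cite: Balaban1982Higgs1, (2.30) p.611] -/
theorem exists_gaussOps {msq a : ℝ} (hmsq : 0 < msq) (ha : 0 < a) (hL : 1 < (P.L : ℝ)) (hj : j ≤ P.K) :
    ∃ M G : EuclideanSpace ℝ (PBond P j) →ₗ[ℝ] EuclideanSpace ℝ (PBond P j),
      (∀ x y, ⟪M x, y⟫_ℝ = ⟪x, M y⟫_ℝ) ∧ M ∘ₗ G = LinearMap.id ∧
      (∀ v, Real.exp (-(1 / 2) * ⟪v, M v⟫_ℝ) = gaussWeight P msq a j (WithLp.ofLp v)) ∧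
      Integrable (fun v : EuclideanSpace ℝ (PBond P j) => Real.exp (-(1 / 2) * ⟪v, M v⟫_ℝ)) ∧
      (∀ g h : VecField P j,
        ⟪G ((P.mesh j ^ P.d) • (WithLp.toLp 2 g : EuclideanSpace ℝ (PBond P j))),
          (P.mesh j ^ P.d) • (WithLp.toLp 2 h : EuclideanSpace ℝ (PBond P j))⟫_ℝ
            = siteInner (toSite h) (fluctCov P msq a j (toSite g))) ∧
      ∫ v : EuclideanSpace ℝ (PBond P j), Real.exp (-(1 / 2) * ⟪v, M v⟫_ℝ) = gaussNorm P msq a j := by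
  have hc : (0 : ℝ) < P.mesh j ^ P.d := pow_pos (P.mesh_pos j) _
  -- the two linear identifications `E → fields`, `fields → E`
  obtain ⟨T, hT⟩ : ∃ T : EuclideanSpace ℝ (PBond P j) →ₗ[ℝ] ScalarField P j P.d,
      ∀ v, T v = toSite (WithLp.ofLp v : VecField P j) :=
    ⟨{ toFun := fun v => toSite (WithLp.ofLp v : VecField P j)
       map_add' := fun v w => by simp only [WithLp.ofLp_add, toSite_add]
       map_smul' := fun r v => by simp only [WithLp.ofLp_smul, toSite_smul, RingHom.id_apply] },
      fun _ => rfl⟩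
  obtain ⟨S, hS⟩ : ∃ S : ScalarField P j P.d →ₗ[ℝ] EuclideanSpace ℝ (PBond P j),
      ∀ φ, S φ = WithLp.toLp 2 (ofSite φ) :=
    ⟨{ toFun := fun φ => WithLp.toLp 2 (ofSite φ)
       map_add' := fun φ ψ => by simp only [ofSite_add, WithLp.toLp_add]
       map_smul' := fun r φ => by
         rw [RingHom.id_apply, ← WithLp.toLp_smul]
         congr 1 },
      fun _ => rfl⟩
  have hTS : ∀ φ, T (S φ) = φ := fun φ => by rw [hS, hT, WithLp.ofLp_toLp, toSite_ofSite]
  have hST : ∀ v, S (T v) = v := fun v => by rw [hT, hS, ofSite_toSite, WithLp.toLp_ofLp]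
  have hSinner : ∀ (v : EuclideanSpace ℝ (PBond P j)) (φ : ScalarField P j P.d),
      P.mesh j ^ P.d * ⟪v, S φ⟫_ℝ = siteInner (T v) φ := fun v φ => by
    rw [hT, hS, ← siteInner_toSite_ofLp, WithLp.ofLp_toLp, toSite_ofSite]
  have hPC : ∀ φ, precOp P msq a j (fluctCov P msq a j φ) = φ := fun φ => by
    have h := congrArg (fun R : Module.End ℝ (ScalarField P j P.d) => R φ)
      (HiggsFluctMeasurePos.precOp_mul_fluctCov hmsq ha hL hj)
    simpa using h
  -- `M` and `G`
  obtain ⟨M, hM⟩ : ∃ M : EuclideanSpace ℝ (PBond P j) →ₗ[ℝ] EuclideanSpace ℝ (PBond P j),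
      ∀ v, M v = (P.mesh j ^ P.d) • S (precOp P msq a j (T v)) :=
    ⟨(P.mesh j ^ P.d) • (S ∘ₗ precOp P msq a j ∘ₗ T), fun _ => rfl⟩
  obtain ⟨G, hG⟩ : ∃ G : EuclideanSpace ℝ (PBond P j) →ₗ[ℝ] EuclideanSpace ℝ (PBond P j),
      ∀ v, G v = (P.mesh j ^ P.d)⁻¹ • S (fluctCov P msq a j (T v)) :=
    ⟨(P.mesh j ^ P.d)⁻¹ • (S ∘ₗ fluctCov P msq a j ∘ₗ T), fun _ => rfl⟩
  have hMinner : ∀ v w, ⟪v, M w⟫_ℝ = siteInner (T v) (precOp P msq a j (T w)) := fun v w => by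
    rw [hM, real_inner_smul_right, hSinner]
  have hMsymm : ∀ v w, ⟪M v, w⟫_ℝ = ⟪v, M w⟫_ℝ := fun v w => by
    rw [real_inner_comm, hMinner, hMinner, siteInner_precOp_comm]
  have hMG : M ∘ₗ G = LinearMap.id := by
    refine LinearMap.ext fun v => ?_
    rw [LinearMap.comp_apply, LinearMap.id_apply, hG, map_smul, hM, hTS, hPC, hST, smul_smul,
      inv_mul_cancel₀ hc.ne', one_smul]
  have hW : ∀ v, Real.exp (-(1 / 2) * ⟪v, M v⟫_ℝ) = gaussWeight P msq a j (WithLp.ofLp v) := fun v => by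
    rw [hMinner, hT, gaussWeight_eq]
  have hmp := EuclideanSpace.volume_preserving_symm_measurableEquiv_toLp (PBond P j)
  have hint : Integrable (fun v : EuclideanSpace ℝ (PBond P j) => Real.exp (-(1 / 2) * ⟪v, M v⟫_ℝ)) := by
    have h := (hmp.integrable_comp_emb (MeasurableEquiv.measurableEmbedding _)).mpr
      (integrable_gaussWeight hmsq ha hL hj)
    refine h.congr (Filter.Eventually.of_forall fun v => ?_)
    simp only [Function.comp_apply, MeasurableEquiv.toLp_symm_apply]
    exact (hW v).symm
  have hGJ : ∀ g h : VecField P j,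
      ⟪G ((P.mesh j ^ P.d) • (WithLp.toLp 2 g : EuclideanSpace ℝ (PBond P j))),
        (P.mesh j ^ P.d) • (WithLp.toLp 2 h : EuclideanSpace ℝ (PBond P j))⟫_ℝ
          = siteInner (toSite h) (fluctCov P msq a j (toSite g)) := fun g h => by
    rw [map_smul, hG, smul_smul, mul_inv_cancel₀ hc.ne', one_smul, real_inner_comm, real_inner_smul_left, hSinner]
    simp only [hT]
  have hZ : ∫ v : EuclideanSpace ℝ (PBond P j), Real.exp (-(1 / 2) * ⟪v, M v⟫_ℝ) = gaussNorm P msq a j := by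
    simp_rw [hW]
    rw [gaussNorm_eq]
    exact (integral_vecField_eq_integral_euclidean (gaussWeight P msq a j)).symm
  exact ⟨M, G, hMsymm, hMG, hW, hint, hGJ, hZ⟩

/-- **`dμ_{C^{(j),L^jη}}` is centred**: `∫⟨A′_j, f⟩ dμ_{C^{(j),L^jη}}(A′_j) = 0` for every bond function `f` — unconditional
(odd integrand, even weight, reflection-invariant `dA′`; no integrability needed). [cite: Balaban1982Higgs1, p.617] -/
theorem integral_siteInner_fluctMeasure (msq a : ℝ) (j : ℕ) (f : VecField P j) :
    ∫ A, siteInner (toSite A) (toSite f) ∂(fluctMeasure P msq a j) = 0 := by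
  rw [integral_fluctMeasure]
  have h := integral_neg_eq_self
    (fun A : VecField P j => gaussWeight P msq a j A • siteInner (toSite A) (toSite f)) volume
  simp only [gaussWeight_neg, siteInner_toSite_neg, smul_eq_mul, mul_neg, integral_neg] at h
  have h0 : ∫ A : VecField P j, gaussWeight P msq a j A * siteInner (toSite A) (toSite f) = 0 := by linarith
  simp only [smul_eq_mul, h0, mul_zero]

/-- **`dμ_{C^{(j),L^jη}}` HAS COVARIANCE `C^{(j),L^jη}`** (p. 617: *"Gaussian random variables with the covariances
C^{(j),L^jε}"*; (2.30): the covariance *"defined by means of the quadratic form"*):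
`∫⟨A′_j, f⟩⟨A′_j, g⟩ dμ_{C^{(j),L^jη}}(A′_j) = ⟨f, C^{(j),L^jη}g⟩` for all bond functions `f, g` (`⟨·,·⟩` = (1.5) on `T^{(j)}`,
bond functions read as `ℝ^d`-valued site functions, p. 608), `msq > 0`, `a > 0`, `L > 1`, `j ≤ K`. PROVED.
[cite: Balaban1982Higgs1, (2.30) p.611] -/
theorem integral_siteInner_mul_siteInner_fluctMeasure {msq a : ℝ} (hmsq : 0 < msq) (ha : 0 < a)
    (hL : 1 < (P.L : ℝ)) (hj : j ≤ P.K) (f g : VecField P j) :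
    ∫ A, siteInner (toSite A) (toSite f) * siteInner (toSite A) (toSite g) ∂(fluctMeasure P msq a j)
      = siteInner (toSite f) (fluctCov P msq a j (toSite g)) := by
  obtain ⟨M, G, hMsymm, hMG, hW, hint, hGJ, hZ⟩ := exists_gaussOps hmsq ha hL hj
  have hgN : gaussNorm P msq a j ≠ 0 := (HiggsFluctMeasurePos.gaussNorm_pos hmsq ha hL hj).ne'
  rw [integral_fluctMeasure]
  have h1 : ∫ A : VecField P j, gaussWeight P msq a j A •
        (siteInner (toSite A) (toSite f) * siteInner (toSite A) (toSite g))
      = ∫ v : EuclideanSpace ℝ (PBond P j), Real.exp (-(1 / 2) * ⟪v, M v⟫_ℝ) *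
          (⟪v, (P.mesh j ^ P.d) • (WithLp.toLp 2 f : EuclideanSpace ℝ (PBond P j))⟫_ℝ *
            ⟪v, (P.mesh j ^ P.d) • (WithLp.toLp 2 g : EuclideanSpace ℝ (PBond P j))⟫_ℝ) := by
    refine (integral_vecField_eq_integral_euclidean _).trans
      (integral_congr_ae (Filter.Eventually.of_forall fun v => ?_))
    simp only [hW, inner_smul_toLp, smul_eq_mul]
  rw [h1, integral_gauss_bilinear volume M G hMsymm hMG hint, hZ, hGJ, smul_eq_mul, inv_mul_eq_div,
    mul_div_assoc, div_self hgN, mul_one]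

/-- **The moment generating function of `dμ_{C^{(j),L^jη}}`**: `∫ e^{⟨A′_j, f⟩} dμ_{C^{(j),L^jη}}(A′_j) = e^{½⟨f, C^{(j),L^jη}f⟩}`
— `dμ_{C^{(j)}}` IS the Gaussian measure with covariance `C^{(j),L^jη}` (completing the square, translation invariance of
`dA′`); `msq > 0`, `a > 0`, `L > 1`, `j ≤ K`. PROVED. [cite: Balaban1982Higgs1, (2.30) p.611] -/
theorem integral_exp_siteInner_fluctMeasure {msq a : ℝ} (hmsq : 0 < msq) (ha : 0 < a) (hL : 1 < (P.L : ℝ))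
    (hj : j ≤ P.K) (f : VecField P j) :
    ∫ A, Real.exp (siteInner (toSite A) (toSite f)) ∂(fluctMeasure P msq a j)
      = Real.exp ((1 / 2) * siteInner (toSite f) (fluctCov P msq a j (toSite f))) := by
  obtain ⟨M, G, hMsymm, hMG, hW, -, hGJ, hZ⟩ := exists_gaussOps hmsq ha hL hj
  have hgN : gaussNorm P msq a j ≠ 0 := (HiggsFluctMeasurePos.gaussNorm_pos hmsq ha hL hj).ne'
  rw [integral_fluctMeasure]
  have h1 : ∫ A : VecField P j, gaussWeight P msq a j A • Real.exp (siteInner (toSite A) (toSite f))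
      = ∫ v : EuclideanSpace ℝ (PBond P j), Real.exp (-(1 / 2) * ⟪v, M v⟫_ℝ +
          ⟪v, (P.mesh j ^ P.d) • (WithLp.toLp 2 f : EuclideanSpace ℝ (PBond P j))⟫_ℝ) := by
    refine (integral_vecField_eq_integral_euclidean _).trans
      (integral_congr_ae (Filter.Eventually.of_forall fun v => ?_))
    simp only [Real.exp_add, hW, inner_smul_toLp, smul_eq_mul]
  have h2 : ∫ v : EuclideanSpace ℝ (PBond P j), Real.exp (-(1 / 2) * ⟪v, M v⟫_ℝ +
          ⟪v, (P.mesh j ^ P.d) • (WithLp.toLp 2 f : EuclideanSpace ℝ (PBond P j))⟫_ℝ)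
      = Real.exp ((1 / 2) * siteInner (toSite f) (fluctCov P msq a j (toSite f))) * gaussNorm P msq a j := by
    set J : EuclideanSpace ℝ (PBond P j) := (P.mesh j ^ P.d) • (WithLp.toLp 2 f : EuclideanSpace ℝ (PBond P j))
      with hJ
    have hJG : ⟪J, G J⟫_ℝ = siteInner (toSite f) (fluctCov P msq a j (toSite f)) := by
      rw [← real_inner_comm J (G J), hJ]
      exact hGJ f f
    calc ∫ v : EuclideanSpace ℝ (PBond P j), Real.exp (-(1 / 2) * ⟪v, M v⟫_ℝ + ⟪v, J⟫_ℝ)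
        = ∫ v : EuclideanSpace ℝ (PBond P j), Real.exp ((1 / 2) * ⟪J, G J⟫_ℝ) *
            Real.exp (-(1 / 2) * ⟪v - G J, M (v - G J)⟫_ℝ) := by
          simp_rw [gauss_shift_eq M G hMsymm hMG J]
      _ = Real.exp ((1 / 2) * ⟪J, G J⟫_ℝ) *
            ∫ v : EuclideanSpace ℝ (PBond P j), Real.exp (-(1 / 2) * ⟪v - G J, M (v - G J)⟫_ℝ) :=
          integral_const_mul _ _
      _ = Real.exp ((1 / 2) * ⟪J, G J⟫_ℝ) *
            ∫ v : EuclideanSpace ℝ (PBond P j), Real.exp (-(1 / 2) * ⟪v, M v⟫_ℝ) :=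
          congrArg _ (integral_sub_right_eq_self (fun v => Real.exp (-(1 / 2) * ⟪v, M v⟫_ℝ)) (G J))
      _ = Real.exp ((1 / 2) * siteInner (toSite f) (fluctCov P msq a j (toSite f))) * gaussNorm P msq a j := by
          rw [hZ, hJG]
  rw [h1, h2, smul_eq_mul, inv_mul_eq_div, mul_div_assoc, div_self hgN, mul_one]

end Moments

end Literature.MathematicalPhysics.QuantumFieldTheory.Balaban1983to89.HiggsFluctMeasureCov
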